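import Summits.QuantumFields.BalabanUV.Beta.D1BFx.NeedleNdlDipRowLetters

/-!
# `BalabanUV.Beta.D1BFx.NeedleNdlDipColLetters` — road «BF-x» for binder row D1, slot (K), END row `hGrp gN`, «GN-33 ∕ NK+KN» LETTERS (column side):
# THE PAIRINGS OF THE NEEDLE's COMBINED COLUMN `C_u = cQ·Σ_{z∈B(blk u)}P(z,·) − kerP(·, blk u)` WITH THE DIPOLE PIECE's FUNCTIONS THROUGH THE GLUON LEG —
# `S3(χ) = ⟨∇C_u, Ga χ⟩` and `S2(χ) = ⟨Ga∇C_u, χ⟩` for a FLAT damped `χ` (`∇p_b`, `∇δp_b`) and a COULOMB profile `χ` (`∇ρ_b`), and `S3` for a DIPOLE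
# VALUE profile `f` (`δρ_b`, `χ = ∇f`) — generic in the dip function, n-powers explicit, site damping `e^{−(δ∕4n)‖u−b‖}`

HONEST DEPENDENCY (cell records, verbatim): «continuum YM on T⁴ ⇐ BetaPertH ∧ nine spine estimates (0/9 proved); BetaPertH ⇐ (D1) ∧ (D4) ∧
CAP+tail; G-an2-4 gates asym, D1 and NE2/3/4.»  HONEST FRAMING (cell contract, verbatim): «discharging `BetaPertH` makes Bałaban's UV stability
UNCONDITIONAL — a real constructive-QFT result; it is NOT the continuum limit and NOT the Clay problem.»  THIS MODULE DISCHARGES NOTHING of the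
wall: [folklore] lattice bookkeeping over gan24-leaf-05-g42's generic letter forms `NeedleNdlNdlLetters.abs_pairing_flat_leg_flat_le` ∕
`abs_pairing_flat_leg_needle_le` ∕ `abs_pairing_needle_leg_flat_le` and `NeedleNdlNdlLetterForms` (`abs_grad_col_le` — the owner's `NeedleColumnLetters.abs_gradC_le`
read at a site rate —, brackets `c0_le`∕`c1_le`∕`c2_le`∕`c3_le`), leaf-04-g9's `PairingByParts.abs_applyK_grad_le_of_damped_profiles`, HLS kit
`LatticeHLSDamped.abs_sum_mul_le_of_damped_flat`, `NeedleHLSGain.abs_pairing_le_of_needle_left`.  The leg and the dip functions enter ONLY through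
profile HYPOTHESES (fed later by `NeedleDipDipLetters.exists_legLetters` ∕ `exists_functionLetters`, modulo [B5, Prop. 1.2] ∧ [B5, (1.126)–(1.127)]
BY NAME).  No `def`, no `def … : Prop`, nothing cited, 0 sorry.  Root-level binders hW ∕ hR-sockets ∕ hSX-socket ∕ D1Tel ∕ D1Rep — 0 discharged;
(K) NOT closed; NOT D1, NOT `BetaPertH`, NOT continuum, NOT Clay.

ABSOLUTE RULE (cell charter, verbatim): «No internally-minted statement may enter as a cited fact. Every hypothesis is either kernel-proved in
this package or a verbatim quotation of a PUBLISHED theorem with page reference. The manuscript(s) under audit are NOT citable for their own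
disputed steps — they are the thing under adjudication; programme-internal (2001/route/tribunal) claims are never citable.»

WHY (owner d1-p2 gen 11 RULING ρ-g11-2 ∕ ρ-g11-3; my statement line l.31599).  The column factors of the sixteen pairings of the `ndl ⊗ dip` word.
COUNT at rate `ε = δ∕n` (`|∇C_u(q)| ≤ (C₀∕n)·e^{−ε‖q−u‖}`, `C₀ = (|cQ|·cPPs + cPs)·e^{δ_C}`): flat `χ` (`|χ| ≤ Bg·e^{−ε‖x−b‖}`): `K·Bg·n⁵·e^{−(δ∕4n)‖u−b‖}`
(`∇p_b`: `Bg = cF∕n⁵` ⇒ n⁰; `∇δp_b`: `cF∕n⁶` ⇒ n⁻¹); Coulomb `χ` (`≤ Bρ·e∕nrm(x−b)³`): `K·Bρ·n²·e^{−(δ∕4n)‖u−b‖}` (`Bρ = kR∕n²` ⇒ n⁰); dipole value `f`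
(`≤ Bδ·e∕nrm³`, `χ = Ga∇f` by parts inside the leg ↦ `e∕nrm²`): `S3 ≤ K·Bδ·n·e^{−(δ∕4n)‖u−b‖}` (`Bδ = kR∕n²` ⇒ n⁻¹).
* §1 [folklore] **`exists_col_leg_flat_bound`** (S3, flat), **`exists_leg_col_flat_bound`** (S2, flat).
* §2 [folklore] **`exists_col_leg_coul_bound`** (S3, Coulomb), **`exists_leg_col_coul_bound`** (S2, Coulomb).
* §3 [folklore] **`exists_col_leg_dip_bound`** (S3, dipole value).
NOT HERE (honest): `S2(δρ)` (by parts ON `Ga∇C_u` — `NeedleNdlDipByParts`), the needle-row letters (`NeedleNdlDipRowLetters`), the word, the census.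
Unit `b2b-balaban-beta-d1-formalise-leaf-01` (gen 15), D1 formalisation swarm LEAF PROVER 01; `LEAVES-BFx.md` row (N) «GN-33∕NK+KN» letters 2.
-/

noncomputable section

namespace Summit.QuantumFields.BalabanUV.Beta.D1BFx.NeedleNdlDipColLetters

open Finset
open scoped BigOperators
open Literature.MathematicalPhysics.QuantumFieldTheory.Balaban1983to89
open Literature.MathematicalPhysics.QuantumFieldTheory.Balaban1983to89.Beta
open B6QGQLower276 (X e blk B mem_B)
open ExpKernelCalculus (Site MKer)
open Beta.PoissonInterior (nrm nrm_pos nrm_neg)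
open DyadicShell (Pt)
open AffineAveraging (unitVec)
open Summit.QuantumFields.BalabanUV.Beta.D1BFx.RProjector (Pgt kerP deltaPP deltaP deltaPP_pos deltaP_pos)
open Summit.QuantumFields.BalabanUV.Beta.D1BFx.ProjectorSupNorm (cPPs cPs cPPs_nonneg cPs_nonneg)
open Summit.QuantumFields.BalabanUV.Beta.D1BFx.GluonLeg (Ga)
open Summit.QuantumFields.BalabanUV.Beta.D1BFx.RankOneBubble (pairing applyK pairing_comm)
open Summit.QuantumFields.BalabanUV.Beta.D1BFx.RankOneBubbleJets (grad)
open Summit.QuantumFields.BalabanUV.Beta.D1BFx.LatticeHLSDamped (abs_sum_mul_le_of_damped_flat)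
open Summit.QuantumFields.BalabanUV.Beta.D1BFx.NeedleHLSGain (abs_pairing_le_of_needle_left)
open Summit.QuantumFields.BalabanUV.Beta.D1BFx.PairingByParts (abs_applyK_grad_le_of_damped_profiles)
open Summit.QuantumFields.BalabanUV.Beta.D1BFx.NeedleNdlNdlLetters (abs_pairing_needle_leg_flat_le abs_pairing_flat_leg_needle_le
  abs_pairing_flat_leg_flat_le)
open Summit.QuantumFields.BalabanUV.Beta.D1BFx.NeedleNdlNdlLetterForms (c0_le c1_le c2_le c3_le abs_grad_col_le)
open Summit.QuantumFields.BalabanUV.Beta.D1BFx.NeedleNdlDipRowLetters (exp_rate_quarter)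
open Summit.QuantumFields.BalabanUV.Beta.D1BFx.NeedleNdlNdlPairings (rate_le)

variable {a : ℝ}

/-- [folklore] the damping `e^{−(ε∕2∕2)‖b−u‖}` ∕ `e^{−(ε∕2)‖b−u‖}`, `ε = δ∕n`, read as `e^{−(δ∕4n)‖u−b‖}`. -/
theorem exp_flip_quarter {δ : ℝ} (hδ : 0 ≤ δ) {n : ℕ} (hn : (0 : ℝ) < n) (b u : Site 4) :
    Real.exp (-(δ / n / 2 / 2) * Beta.PoissonInterior.supNorm (b - u)) = Real.exp (-(δ / 4 / n) * Beta.PoissonInterior.supNorm (u - b))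
      ∧ Real.exp (-(δ / n / 2) * Beta.PoissonInterior.supNorm (b - u)) ≤ Real.exp (-(δ / 4 / n) * Beta.PoissonInterior.supNorm (u - b)) := by
  have hflip : Beta.PoissonInterior.supNorm (b - u) = Beta.PoissonInterior.supNorm (u - b) := by
    rw [show b - u = -(u - b) by abel, PoissonInterior.supNorm_neg]
  rw [hflip]
  exact ⟨(exp_rate_quarter hδ hn _).2.2, (exp_rate_quarter hδ hn _).2.1⟩

/-! ## §1 Flat bond functions against the combined column -/

section Flat

/-- [folklore] **S3, FLAT: `|⟨∇C_u, Ga χ⟩| ≤ K·Bg·n⁵·e^{−(δ∕4n)‖u−b‖}`** for every flat damped `|χ x c| ≤ Bg·e^{−(δ∕n)‖x−b‖}`, every leg with the damped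
Coulomb entry profile at rate `δ∕n`, every `|cQ| ≤ cQ₀`, `0 < δ ≤ min δ_PP δ_P`; `K` depends on `δ`, `kA`, `a`, `cQ₀` only (`abs_pairing_flat_leg_flat_le`;
`c2 ≤ c₂'n²`, `c0 ≤ c₀'n⁴`, `|∇C_u| ≤ C₀∕n`). -/
theorem exists_col_leg_flat_bound (ha : 0 < a) {δ kA : ℝ} (hδ0 : 0 < δ) (hδC : δ ≤ min (deltaPP 4 a) (deltaP 4 a)) (hkA : 0 ≤ kA) (cQ₀ : ℝ) :
    ∃ K : ℝ, 0 ≤ K ∧ ∀ (n : ℕ) [NeZero n] (cQ : ℝ), |cQ| ≤ cQ₀ →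
      (∀ (x y : Site 4) (c e : Fin 4), |Ga n a x y c e| ≤ kA * Real.exp (-(δ / n) * Beta.PoissonInterior.supNorm (x - y)) / nrm (x - y) ^ 2) →
      ∀ (Bg : ℝ), 0 ≤ Bg → ∀ (b : Site 4) (χ : Site 4 → Fin 4 → ℝ),
        (∀ (x : Site 4) (c : Fin 4), |χ x c| ≤ Bg * Real.exp (-(δ / n) * Beta.PoissonInterior.supNorm (x - b))) →
        ∀ (u : Site 4),
          |pairing (grad (fun q => cQ * (∑ z ∈ B (n - 1) (blk (n - 1) u), Pgt n a z q () ()) - kerP (d := 4) (n - 1) a q (blk (n - 1) u)))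
              (applyK (Ga n a) χ)|
            ≤ K * Bg * (n : ℝ) ^ 5 * Real.exp (-(δ / 4 / n) * Beta.PoissonInterior.supNorm (u - b)) := by
  have hPP := deltaPP_pos 4 ha; have hP := deltaP_pos 4 ha; have hPPs := cPPs_nonneg 4 ha; have hPs := cPs_nonneg 4 ha
  set δC := min (deltaPP 4 a) (deltaP 4 a) with hδC_def
  set C₁ := (cQ₀ * cPPs 4 a + cPs 4 a) * Real.exp δC with hC₁
  set c2' : ℝ := 1 + 2 * 4 * 3 ^ (4 - 1) * (4 / δ * (1 + 4 / δ)) with hc2'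
  set c0' : ℝ := 1 + 2 * 4 * 3 ^ (4 - 1) * (6 * (8 / δ) ^ 3 * (1 + 8 / δ)) with hc0'
  refine ⟨4 * |C₁| * (4 * kA * c2') * c0', by positivity, fun n _ cQ hcQ hA Bg hBg b χ hχ u => ?_⟩
  have hn : (0 : ℝ) < n := by exact_mod_cast Nat.pos_of_ne_zero (NeZero.ne n)
  have hn1 : 1 ≤ n := NeZero.one_le
  set ε := δ / n with hε
  have hε0 : 0 < ε := div_pos hδ0 hn
  set C₀ := (|cQ| * cPPs 4 a + cPs 4 a) * Real.exp δC with hC₀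
  have hC₀0 : 0 ≤ C₀ := by positivity
  have hC₀1 : C₀ ≤ |C₁| := by
    refine le_trans ?_ (le_abs_self _)
    rw [hC₀, hC₁]; gcongr
  have hψ : ∀ (q : Site 4) (c : Fin 4),
      |grad (fun q => cQ * (∑ z ∈ B (n - 1) (blk (n - 1) u), Pgt n a z q () ()) - kerP (d := 4) (n - 1) a q (blk (n - 1) u)) q c|
        ≤ C₀ / n * Real.exp (-ε * Beta.PoissonInterior.supNorm (q - u)) :=
    fun q c => abs_grad_col_le n cQ ha (rate_le hδC hn) u q c
  have h := abs_pairing_flat_leg_flat_le (F := Fin 4) (A := Ga n a) hkA (by positivity : 0 ≤ C₀ / n) hBg hε0 u b hA hψ hχ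
  refine h.trans ?_
  have hc2 : 1 + 2 * 4 * 3 ^ (4 - 1) * ((4 - 1 - 2).factorial * (2 / (ε / 2)) ^ (4 - 1 - 2) * (1 + 2 / (ε / 2))) ≤ c2' * (n : ℝ) ^ 2 :=
    c2_le hδ0 hn1
  have hc0 : 1 + 2 * 4 * 3 ^ (4 - 1) * ((4 - 1 - 0).factorial * (2 / (ε / 2 / 2)) ^ (4 - 1 - 0) * (1 + 2 / (ε / 2 / 2))) ≤ c0' * (n : ℝ) ^ 4 :=
    c0_le hδ0 hn1
  have hc0_0 : 0 ≤ 1 + 2 * 4 * 3 ^ (4 - 1) * ((4 - 1 - 0).factorial * (2 / (ε / 2 / 2)) ^ (4 - 1 - 0) * (1 + 2 / (ε / 2 / 2))) := by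
    positivity
  have hcard : (Fintype.card (Fin 4) : ℝ) = 4 := by simp
  -- `flat_leg_flat` damps in `‖u − b‖` already (ψ at u, χ at b)
  have hE : Real.exp (-(ε / 2 / 2) * Beta.PoissonInterior.supNorm (u - b)) = Real.exp (-(δ / 4 / n) * Beta.PoissonInterior.supNorm (u - b)) := by
    rw [hε]; exact (exp_rate_quarter hδ0.le hn _).2.2
  rw [hcard, hE]
  calc (4 : ℝ) * (C₀ / n) * (4 * kA * Bg *
        (1 + 2 * 4 * 3 ^ (4 - 1) * ((4 - 1 - 2).factorial * (2 / (ε / 2)) ^ (4 - 1 - 2) * (1 + 2 / (ε / 2))))) *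
        Real.exp (-(δ / 4 / n) * Beta.PoissonInterior.supNorm (u - b)) *
        (1 + 2 * 4 * 3 ^ (4 - 1) * ((4 - 1 - 0).factorial * (2 / (ε / 2 / 2)) ^ (4 - 1 - 0) * (1 + 2 / (ε / 2 / 2))))
      ≤ 4 * (|C₁| / n) * (4 * kA * Bg * (c2' * (n : ℝ) ^ 2)) * Real.exp (-(δ / 4 / n) * Beta.PoissonInterior.supNorm (u - b)) * (c0' * (n : ℝ) ^ 4) := by
        gcongr
    _ = 4 * |C₁| * (4 * kA * c2') * c0' * Bg * (n : ℝ) ^ 5 * Real.exp (-(δ / 4 / n) * Beta.PoissonInterior.supNorm (u - b)) := by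
        field_simp

/-- [folklore] **S2, FLAT: `|⟨Ga∇C_u, χ⟩| ≤ K·Bg·n⁵·e^{−(δ∕4n)‖u−b‖}`** (`pairing_comm`, then `abs_pairing_flat_leg_flat_le` with `χ` outside and `∇C_u` inside;
the damping `e^{−(ε∕4)‖b−u‖}` read as `e^{−(δ∕4n)‖u−b‖}`). -/
theorem exists_leg_col_flat_bound (ha : 0 < a) {δ kA : ℝ} (hδ0 : 0 < δ) (hδC : δ ≤ min (deltaPP 4 a) (deltaP 4 a)) (hkA : 0 ≤ kA) (cQ₀ : ℝ) :
    ∃ K : ℝ, 0 ≤ K ∧ ∀ (n : ℕ) [NeZero n] (cQ : ℝ), |cQ| ≤ cQ₀ →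
      (∀ (x y : Site 4) (c e : Fin 4), |Ga n a x y c e| ≤ kA * Real.exp (-(δ / n) * Beta.PoissonInterior.supNorm (x - y)) / nrm (x - y) ^ 2) →
      ∀ (Bg : ℝ), 0 ≤ Bg → ∀ (b : Site 4) (χ : Site 4 → Fin 4 → ℝ),
        (∀ (x : Site 4) (c : Fin 4), |χ x c| ≤ Bg * Real.exp (-(δ / n) * Beta.PoissonInterior.supNorm (x - b))) →
        ∀ (u : Site 4),
          |pairing (applyK (Ga n a) (grad (fun q => cQ * (∑ z ∈ B (n - 1) (blk (n - 1) u), Pgt n a z q () ()) - kerP (d := 4) (n - 1) a q (blk (n - 1) u))))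
              χ|
            ≤ K * Bg * (n : ℝ) ^ 5 * Real.exp (-(δ / 4 / n) * Beta.PoissonInterior.supNorm (u - b)) := by
  have hPP := deltaPP_pos 4 ha; have hP := deltaP_pos 4 ha; have hPPs := cPPs_nonneg 4 ha; have hPs := cPs_nonneg 4 ha
  set δC := min (deltaPP 4 a) (deltaP 4 a) with hδC_def
  set C₁ := (cQ₀ * cPPs 4 a + cPs 4 a) * Real.exp δC with hC₁
  set c2' : ℝ := 1 + 2 * 4 * 3 ^ (4 - 1) * (4 / δ * (1 + 4 / δ)) with hc2'
  set c0' : ℝ := 1 + 2 * 4 * 3 ^ (4 - 1) * (6 * (8 / δ) ^ 3 * (1 + 8 / δ)) with hc0'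
  refine ⟨4 * (4 * kA * |C₁| * c2') * c0', by positivity, fun n _ cQ hcQ hA Bg hBg b χ hχ u => ?_⟩
  have hn : (0 : ℝ) < n := by exact_mod_cast Nat.pos_of_ne_zero (NeZero.ne n)
  have hn1 : 1 ≤ n := NeZero.one_le
  set ε := δ / n with hε
  have hε0 : 0 < ε := div_pos hδ0 hn
  set C₀ := (|cQ| * cPPs 4 a + cPs 4 a) * Real.exp δC with hC₀
  have hC₀0 : 0 ≤ C₀ := by positivity
  have hC₀1 : C₀ ≤ |C₁| := by
    refine le_trans ?_ (le_abs_self _)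
    rw [hC₀, hC₁]; gcongr
  have hχ' : ∀ (q : Site 4) (c : Fin 4),
      |grad (fun q => cQ * (∑ z ∈ B (n - 1) (blk (n - 1) u), Pgt n a z q () ()) - kerP (d := 4) (n - 1) a q (blk (n - 1) u)) q c|
        ≤ C₀ / n * Real.exp (-ε * Beta.PoissonInterior.supNorm (q - u)) :=
    fun q c => abs_grad_col_le n cQ ha (rate_le hδC hn) u q c
  rw [pairing_comm]
  have h := abs_pairing_flat_leg_flat_le (F := Fin 4) (A := Ga n a) hkA hBg (by positivity : 0 ≤ C₀ / n) hε0 b u hA hχ hχ'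
  refine h.trans ?_
  have hc2 : 1 + 2 * 4 * 3 ^ (4 - 1) * ((4 - 1 - 2).factorial * (2 / (ε / 2)) ^ (4 - 1 - 2) * (1 + 2 / (ε / 2))) ≤ c2' * (n : ℝ) ^ 2 :=
    c2_le hδ0 hn1
  have hc0 : 1 + 2 * 4 * 3 ^ (4 - 1) * ((4 - 1 - 0).factorial * (2 / (ε / 2 / 2)) ^ (4 - 1 - 0) * (1 + 2 / (ε / 2 / 2))) ≤ c0' * (n : ℝ) ^ 4 :=
    c0_le hδ0 hn1
  have hcard : (Fintype.card (Fin 4) : ℝ) = 4 := by simp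
  have hE : Real.exp (-(ε / 2 / 2) * Beta.PoissonInterior.supNorm (b - u)) = Real.exp (-(δ / 4 / n) * Beta.PoissonInterior.supNorm (u - b)) := by
    rw [hε]; exact (exp_flip_quarter hδ0.le hn b u).1
  rw [hcard, hE]
  calc (4 : ℝ) * Bg * (4 * kA * (C₀ / n) *
        (1 + 2 * 4 * 3 ^ (4 - 1) * ((4 - 1 - 2).factorial * (2 / (ε / 2)) ^ (4 - 1 - 2) * (1 + 2 / (ε / 2))))) *
        Real.exp (-(δ / 4 / n) * Beta.PoissonInterior.supNorm (u - b)) *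
        (1 + 2 * 4 * 3 ^ (4 - 1) * ((4 - 1 - 0).factorial * (2 / (ε / 2 / 2)) ^ (4 - 1 - 0) * (1 + 2 / (ε / 2 / 2))))
      ≤ 4 * Bg * (4 * kA * (|C₁| / n) * (c2' * (n : ℝ) ^ 2)) * Real.exp (-(δ / 4 / n) * Beta.PoissonInterior.supNorm (u - b)) * (c0' * (n : ℝ) ^ 4) := by
        gcongr
    _ = 4 * (4 * kA * |C₁| * c2') * c0' * Bg * (n : ℝ) ^ 5 * Real.exp (-(δ / 4 / n) * Beta.PoissonInterior.supNorm (u - b)) := by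
        field_simp

end Flat

/-! ## §2 A Coulomb profile at the dip bond against the combined column (`∇ρ_b`) -/

section Coulomb

/-- [folklore] **S3, COULOMB: `|⟨∇C_u, Ga χ⟩| ≤ K·Bρ·n²·e^{−(δ∕4n)‖u−b‖}`** for `|χ x c| ≤ Bρ·e^{−(δ∕n)‖x−b‖}∕nrm(x−b)³` (`abs_pairing_flat_leg_needle_le` with the
one-site needle `{b}` inside: leg (2) × cubic ↦ exponent 1, then flat × exponent-1 damped sum `c1 ≤ c₁'n³`; `|∇C_u| ≤ C₀∕n`; rate `ε∕2` weakened to `δ∕4n`). -/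
theorem exists_col_leg_coul_bound (ha : 0 < a) {δ kA : ℝ} (hδ0 : 0 < δ) (hδC : δ ≤ min (deltaPP 4 a) (deltaP 4 a)) (hkA : 0 ≤ kA) (cQ₀ : ℝ) :
    ∃ K : ℝ, 0 ≤ K ∧ ∀ (n : ℕ) [NeZero n] (cQ : ℝ), |cQ| ≤ cQ₀ →
      (∀ (x y : Site 4) (c e : Fin 4), |Ga n a x y c e| ≤ kA * Real.exp (-(δ / n) * Beta.PoissonInterior.supNorm (x - y)) / nrm (x - y) ^ 2) →
      ∀ (Bρ : ℝ), 0 ≤ Bρ → ∀ (b : Site 4) (χ : Site 4 → Fin 4 → ℝ),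
        (∀ (x : Site 4) (c : Fin 4), |χ x c| ≤ Bρ * Real.exp (-(δ / n) * Beta.PoissonInterior.supNorm (x - b)) / nrm (x - b) ^ 3) →
        ∀ (u : Site 4),
          |pairing (grad (fun q => cQ * (∑ z ∈ B (n - 1) (blk (n - 1) u), Pgt n a z q () ()) - kerP (d := 4) (n - 1) a q (blk (n - 1) u)))
              (applyK (Ga n a) χ)|
            ≤ K * Bρ * (n : ℝ) ^ 2 * Real.exp (-(δ / 4 / n) * Beta.PoissonInterior.supNorm (u - b)) := by
  have hPP := deltaPP_pos 4 ha; have hP := deltaP_pos 4 ha; have hPPs := cPPs_nonneg 4 ha; have hPs := cPs_nonneg 4 ha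
  set δC := min (deltaPP 4 a) (deltaP 4 a) with hδC_def
  set C₁ := (cQ₀ * cPPs 4 a + cPs 4 a) * Real.exp δC with hC₁
  set C₄ : ℝ := 4 * 2 ^ (4 + 3) * 9 ^ (4 - 1) with hC₄
  set c1' : ℝ := 1 + 2 * 4 * 3 ^ (4 - 1) * (2 * (4 / δ) ^ 2 * (1 + 4 / δ)) with hc1'
  refine ⟨4 * (4 * kA * C₄ * |C₁| * c1'), by positivity, fun n _ cQ hcQ hA Bρ hBρ b χ hχ u => ?_⟩
  have hn : (0 : ℝ) < n := by exact_mod_cast Nat.pos_of_ne_zero (NeZero.ne n)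
  have hn1 : 1 ≤ n := NeZero.one_le
  set ε := δ / n with hε
  have hε0 : 0 < ε := div_pos hδ0 hn
  set C₀ := (|cQ| * cPPs 4 a + cPs 4 a) * Real.exp δC with hC₀
  have hC₀0 : 0 ≤ C₀ := by positivity
  have hC₀1 : C₀ ≤ |C₁| := by
    refine le_trans ?_ (le_abs_self _)
    rw [hC₀, hC₁]; gcongr
  have hψ : ∀ (q : Site 4) (c : Fin 4),
      |grad (fun q => cQ * (∑ z ∈ B (n - 1) (blk (n - 1) u), Pgt n a z q () ()) - kerP (d := 4) (n - 1) a q (blk (n - 1) u)) q c|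
        ≤ C₀ / n * Real.exp (-ε * Beta.PoissonInterior.supNorm (q - u)) :=
    fun q c => abs_grad_col_le n cQ ha (rate_le hδC hn) u q c
  have hχ' : ∀ (x : Site 4) (c : Fin 4), |χ x c| ≤ ∑ s' ∈ (Finset.univ : Finset Unit), (1 : ℝ) *
      (Bρ * Real.exp (-ε * Beta.PoissonInterior.supNorm (x - (fun _ : Unit => b) s')) / nrm (x - (fun _ : Unit => b) s') ^ 3) := fun x c => by
    simpa [hε] using hχ x c
  have h := abs_pairing_flat_leg_needle_le (F := Fin 4) (A := Ga n a) (Finset.univ : Finset Unit) (q := fun _ => (1 : ℝ))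
    (fun _ _ => zero_le_one) hkA hBρ (by positivity : 0 ≤ C₀ / n) hε0 (fun _ => b) u hA hψ hχ'
  refine h.trans ?_
  have hc1 : 1 + 2 * 4 * 3 ^ (4 - 1) * ((4 - 1 - 1).factorial * (2 / (ε / 2)) ^ (4 - 1 - 1) * (1 + 2 / (ε / 2))) ≤ c1' * (n : ℝ) ^ 3 :=
    c1_le hδ0 hn1
  have hcard : (Fintype.card (Fin 4) : ℝ) = 4 := by simp
  have hE : Real.exp (-(ε / 2) * Beta.PoissonInterior.supNorm (b - u)) ≤ Real.exp (-(δ / 4 / n) * Beta.PoissonInterior.supNorm (u - b)) := by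
    rw [hε]; exact (exp_flip_quarter hδ0.le hn b u).2
  have hS : ∑ s' ∈ (Finset.univ : Finset Unit), (1 : ℝ) * Real.exp (-(ε / 2) * Beta.PoissonInterior.supNorm ((fun _ : Unit => b) s' - u))
      = Real.exp (-(ε / 2) * Beta.PoissonInterior.supNorm (b - u)) := by simp
  rw [hcard, hS]
  calc (4 : ℝ) * (4 * kA * Bρ * (4 * 2 ^ (4 + 3) * 9 ^ (4 - 1)) * (C₀ / n) *
        (1 + 2 * 4 * 3 ^ (4 - 1) * ((4 - 1 - 1).factorial * (2 / (ε / 2)) ^ (4 - 1 - 1) * (1 + 2 / (ε / 2))))) *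
        Real.exp (-(ε / 2) * Beta.PoissonInterior.supNorm (b - u))
      ≤ 4 * (4 * kA * Bρ * (4 * 2 ^ (4 + 3) * 9 ^ (4 - 1)) * (|C₁| / n) * (c1' * (n : ℝ) ^ 3)) *
          Real.exp (-(δ / 4 / n) * Beta.PoissonInterior.supNorm (u - b)) := by gcongr
    _ = 4 * (4 * kA * C₄ * |C₁| * c1') * Bρ * (n : ℝ) ^ 2 * Real.exp (-(δ / 4 / n) * Beta.PoissonInterior.supNorm (u - b)) := by
        rw [hC₄]; field_simp

/-- [folklore] **S2, COULOMB: `|⟨Ga∇C_u, χ⟩| ≤ K·Bρ·n²·e^{−(δ∕4n)‖u−b‖}`** (`pairing_comm`; the one-site needle `{b}` OUTSIDE, the flat column inside: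
`abs_pairing_needle_leg_flat_le`, `c2 ≤ c₂'n²`, `c3 ≤ c₃'n`). -/
theorem exists_leg_col_coul_bound (ha : 0 < a) {δ kA : ℝ} (hδ0 : 0 < δ) (hδC : δ ≤ min (deltaPP 4 a) (deltaP 4 a)) (hkA : 0 ≤ kA) (cQ₀ : ℝ) :
    ∃ K : ℝ, 0 ≤ K ∧ ∀ (n : ℕ) [NeZero n] (cQ : ℝ), |cQ| ≤ cQ₀ →
      (∀ (x y : Site 4) (c e : Fin 4), |Ga n a x y c e| ≤ kA * Real.exp (-(δ / n) * Beta.PoissonInterior.supNorm (x - y)) / nrm (x - y) ^ 2) →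
      ∀ (Bρ : ℝ), 0 ≤ Bρ → ∀ (b : Site 4) (χ : Site 4 → Fin 4 → ℝ),
        (∀ (x : Site 4) (c : Fin 4), |χ x c| ≤ Bρ * Real.exp (-(δ / n) * Beta.PoissonInterior.supNorm (x - b)) / nrm (x - b) ^ 3) →
        ∀ (u : Site 4),
          |pairing (applyK (Ga n a) (grad (fun q => cQ * (∑ z ∈ B (n - 1) (blk (n - 1) u), Pgt n a z q () ()) - kerP (d := 4) (n - 1) a q (blk (n - 1) u))))
              χ|
            ≤ K * Bρ * (n : ℝ) ^ 2 * Real.exp (-(δ / 4 / n) * Beta.PoissonInterior.supNorm (u - b)) := by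
  have hPP := deltaPP_pos 4 ha; have hP := deltaP_pos 4 ha; have hPPs := cPPs_nonneg 4 ha; have hPs := cPs_nonneg 4 ha
  set δC := min (deltaPP 4 a) (deltaP 4 a) with hδC_def
  set C₁ := (cQ₀ * cPPs 4 a + cPs 4 a) * Real.exp δC with hC₁
  set c2' : ℝ := 1 + 2 * 4 * 3 ^ (4 - 1) * (4 / δ * (1 + 4 / δ)) with hc2'
  set c3' : ℝ := 1 + 2 * 4 * 3 ^ (4 - 1) * (1 + 8 / δ) with hc3'
  refine ⟨4 * (4 * kA * |C₁| * c2' * c3'), by positivity, fun n _ cQ hcQ hA Bρ hBρ b χ hχ u => ?_⟩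
  have hn : (0 : ℝ) < n := by exact_mod_cast Nat.pos_of_ne_zero (NeZero.ne n)
  have hn1 : 1 ≤ n := NeZero.one_le
  set ε := δ / n with hε
  have hε0 : 0 < ε := div_pos hδ0 hn
  set C₀ := (|cQ| * cPPs 4 a + cPs 4 a) * Real.exp δC with hC₀
  have hC₀0 : 0 ≤ C₀ := by positivity
  have hC₀1 : C₀ ≤ |C₁| := by
    refine le_trans ?_ (le_abs_self _)
    rw [hC₀, hC₁]; gcongr
  have hχC : ∀ (q : Site 4) (c : Fin 4),
      |grad (fun q => cQ * (∑ z ∈ B (n - 1) (blk (n - 1) u), Pgt n a z q () ()) - kerP (d := 4) (n - 1) a q (blk (n - 1) u)) q c|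
        ≤ C₀ / n * Real.exp (-ε * Beta.PoissonInterior.supNorm (q - u)) :=
    fun q c => abs_grad_col_le n cQ ha (rate_le hδC hn) u q c
  have hψ' : ∀ (x : Site 4) (c : Fin 4), |χ x c| ≤ ∑ s' ∈ (Finset.univ : Finset Unit), (1 : ℝ) *
      (Bρ * Real.exp (-ε * Beta.PoissonInterior.supNorm (x - (fun _ : Unit => b) s')) / nrm (x - (fun _ : Unit => b) s') ^ 3) := fun x c => by
    simpa [hε] using hχ x c
  rw [pairing_comm]
  have h := abs_pairing_needle_leg_flat_le (F := Fin 4) (A := Ga n a) (Finset.univ : Finset Unit) (q := fun _ => (1 : ℝ))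
    (fun _ _ => zero_le_one) hkA hBρ (by positivity : 0 ≤ C₀ / n) hε0 (fun _ => b) u hA hψ' hχC
  refine h.trans ?_
  have hc2 : 1 + 2 * 4 * 3 ^ (4 - 1) * ((4 - 1 - 2).factorial * (2 / (ε / 2)) ^ (4 - 1 - 2) * (1 + 2 / (ε / 2))) ≤ c2' * (n : ℝ) ^ 2 :=
    c2_le hδ0 hn1
  have hc3 : 1 + 2 * 4 * 3 ^ (4 - 1) * ((4 - 1 - 3).factorial * (2 / (ε / 2 / 2)) ^ (4 - 1 - 3) * (1 + 2 / (ε / 2 / 2))) ≤ c3' * (n : ℝ) ^ 1 :=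
    c3_le hδ0 hn1
  have hc3_0 : 0 ≤ 1 + 2 * 4 * 3 ^ (4 - 1) * ((4 - 1 - 3).factorial * (2 / (ε / 2 / 2)) ^ (4 - 1 - 3) * (1 + 2 / (ε / 2 / 2))) := by
    positivity
  have hcard : (Fintype.card (Fin 4) : ℝ) = 4 := by simp
  have hE : Real.exp (-(ε / 2 / 2) * Beta.PoissonInterior.supNorm (b - u)) = Real.exp (-(δ / 4 / n) * Beta.PoissonInterior.supNorm (u - b)) := by
    rw [hε]; exact (exp_flip_quarter hδ0.le hn b u).1
  have hS : ∑ s' ∈ (Finset.univ : Finset Unit), (1 : ℝ) * Real.exp (-(ε / 2 / 2) * Beta.PoissonInterior.supNorm ((fun _ : Unit => b) s' - u))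
      = Real.exp (-(ε / 2 / 2) * Beta.PoissonInterior.supNorm (b - u)) := by simp
  rw [hcard, hS, hE]
  calc (4 : ℝ) * (4 * kA * (C₀ / n) * Bρ *
        (1 + 2 * 4 * 3 ^ (4 - 1) * ((4 - 1 - 2).factorial * (2 / (ε / 2)) ^ (4 - 1 - 2) * (1 + 2 / (ε / 2)))) *
        (1 + 2 * 4 * 3 ^ (4 - 1) * ((4 - 1 - 3).factorial * (2 / (ε / 2 / 2)) ^ (4 - 1 - 3) * (1 + 2 / (ε / 2 / 2))))) *
        Real.exp (-(δ / 4 / n) * Beta.PoissonInterior.supNorm (u - b))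
      ≤ 4 * (4 * kA * (|C₁| / n) * Bρ * (c2' * (n : ℝ) ^ 2) * (c3' * (n : ℝ) ^ 1)) *
          Real.exp (-(δ / 4 / n) * Beta.PoissonInterior.supNorm (u - b)) := by gcongr
    _ = 4 * (4 * kA * |C₁| * c2' * c3') * Bρ * (n : ℝ) ^ 2 * Real.exp (-(δ / 4 / n) * Beta.PoissonInterior.supNorm (u - b)) := by
        field_simp

end Coulomb

/-! ## §3 The dipole value profile at the dip bond against the combined column (`δρ_b`) -/

section Dipole

/-- [folklore] **S3, DIPOLE: `|⟨∇C_u, Ga∇f⟩| ≤ K·Bδ·n·e^{−(δ∕4n)‖u−b‖}`** for a dipole value profile `|f x| ≤ Bδ·e^{−(δ∕n)‖x−b‖}∕nrm(x−b)³` and a leg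
with the letters `kA`, `kA'`, `kA₁` at rate `δ∕n` (`|Ga∇f| ≤ 4kA₁BδC₄·e∕nrm(x−b)²` by parts inside the leg; `pairing_comm`; then the one-site profile of
exponent 2 against the flat column, `abs_sum_mul_le_of_damped_flat`, `c2 ≤ c₂'n²`). -/
theorem exists_col_leg_dip_bound (ha : 0 < a) {δ kA kA' kA₁ : ℝ} (hδ0 : 0 < δ) (hδC : δ ≤ min (deltaPP 4 a) (deltaP 4 a)) (hkA : 0 ≤ kA)
    (hkA' : 0 ≤ kA') (hkA₁ : 0 ≤ kA₁) (cQ₀ : ℝ) :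
    ∃ K : ℝ, 0 ≤ K ∧ ∀ (n : ℕ) [NeZero n] (cQ : ℝ), |cQ| ≤ cQ₀ →
      (∀ (x y : Site 4) (c e : Fin 4), |Ga n a x y c e| ≤ kA * Real.exp (-(δ / n) * Beta.PoissonInterior.supNorm (x - y)) / nrm (x - y) ^ 2) →
      (∀ (x y : Site 4) (c e : Fin 4), |Ga n a x (y - unitVec e) c e| ≤ kA' * Real.exp (-(δ / n) * Beta.PoissonInterior.supNorm (x - y)) / nrm (x - y) ^ 2) →
      (∀ (x y : Site 4) (c e : Fin 4), |Ga n a x (y - unitVec e) c e - Ga n a x y c e|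
          ≤ kA₁ * Real.exp (-(δ / n) * Beta.PoissonInterior.supNorm (x - y)) / nrm (x - y) ^ 3) →
      ∀ (Bδ : ℝ), 0 ≤ Bδ → ∀ (b : Site 4) (f : Site 4 → ℝ),
        (∀ x : Site 4, |f x| ≤ Bδ * Real.exp (-(δ / n) * Beta.PoissonInterior.supNorm (x - b)) / nrm (x - b) ^ 3) →
        ∀ (u : Site 4),
          |pairing (grad (fun q => cQ * (∑ z ∈ B (n - 1) (blk (n - 1) u), Pgt n a z q () ()) - kerP (d := 4) (n - 1) a q (blk (n - 1) u)))
              (applyK (Ga n a) (grad f))|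
            ≤ K * Bδ * n * Real.exp (-(δ / 4 / n) * Beta.PoissonInterior.supNorm (u - b)) := by
  have hPP := deltaPP_pos 4 ha; have hP := deltaP_pos 4 ha; have hPPs := cPPs_nonneg 4 ha; have hPs := cPs_nonneg 4 ha
  set δC := min (deltaPP 4 a) (deltaP 4 a) with hδC_def
  set C₁ := (cQ₀ * cPPs 4 a + cPs 4 a) * Real.exp δC with hC₁
  set C₄ : ℝ := 4 * 2 ^ (4 + 3) * 9 ^ (4 - 1) with hC₄
  set c2' : ℝ := 1 + 2 * 4 * 3 ^ (4 - 1) * (4 / δ * (1 + 4 / δ)) with hc2'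
  refine ⟨4 * (4 * kA₁ * C₄ * |C₁| * c2'), by positivity, fun n _ cQ hcQ hA0 hA0' hA1 Bδ hBδ b f hf u => ?_⟩
  have hn : (0 : ℝ) < n := by exact_mod_cast Nat.pos_of_ne_zero (NeZero.ne n)
  have hn1 : 1 ≤ n := NeZero.one_le
  set ε := δ / n with hε
  have hε0 : 0 < ε := div_pos hδ0 hn
  set C₀ := (|cQ| * cPPs 4 a + cPs 4 a) * Real.exp δC with hC₀
  have hC₀0 : 0 ≤ C₀ := by positivity
  have hC₀1 : C₀ ≤ |C₁| := by
    refine le_trans ?_ (le_abs_self _)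
    rw [hC₀, hC₁]; gcongr
  have hcol : ∀ (q : Site 4) (c : Fin 4),
      |grad (fun q => cQ * (∑ z ∈ B (n - 1) (blk (n - 1) u), Pgt n a z q () ()) - kerP (d := 4) (n - 1) a q (blk (n - 1) u)) q c|
        ≤ C₀ / n * Real.exp (-ε * Beta.PoissonInterior.supNorm (q - u)) :=
    fun q c => abs_grad_col_le n cQ ha (rate_le hδC hn) u q c
  -- the dipole end by parts inside the leg: (3,3) ↦ 2, as a one-site needle
  have hψ : ∀ (x : Site 4) (c : Fin 4), |applyK (Ga n a) (grad f) x c| ≤ ∑ s' ∈ (Finset.univ : Finset Unit), (1 : ℝ) *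
      (4 * kA₁ * Bδ * C₄ * Real.exp (-ε * Beta.PoissonInterior.supNorm (x - b)) / nrm (x - b) ^ 2) := fun x c => by
    have h := abs_applyK_grad_le_of_damped_profiles hkA hkA' hkA₁ hBδ hε0.le b hA0 hA0' hA1 hf x c
    simpa [hC₄] using h
  rw [pairing_comm]
  have h := abs_pairing_le_of_needle_left (F := Fin 4) (Finset.univ : Finset Unit) (q := fun _ => (1 : ℝ)) (fun _ _ => zero_le_one)
    (g := fun _ x => 4 * kA₁ * Bδ * C₄ * Real.exp (-ε * Beta.PoissonInterior.supNorm (x - b)) / nrm (x - b) ^ 2)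
    (h := fun x => C₀ / n * Real.exp (-ε * Beta.PoissonInterior.supNorm (x - u)))
    (G := fun _ => 4 * kA₁ * Bδ * C₄ * (C₀ / n) * Real.exp (-(ε / 2) * Beta.PoissonInterior.supNorm (b - u)) *
      (1 + 2 * 4 * 3 ^ (4 - 1) * ((4 - 1 - 2).factorial * (2 / (ε / 2)) ^ (4 - 1 - 2) * (1 + 2 / (ε / 2)))))
    hψ hcol ?_
  · refine h.2.trans ?_
    have hc2 : 1 + 2 * 4 * 3 ^ (4 - 1) * ((4 - 1 - 2).factorial * (2 / (ε / 2)) ^ (4 - 1 - 2) * (1 + 2 / (ε / 2))) ≤ c2' * (n : ℝ) ^ 2 :=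
      c2_le hδ0 hn1
    have hcard : (Fintype.card (Fin 4) : ℝ) = 4 := by simp
    have hE : Real.exp (-(ε / 2) * Beta.PoissonInterior.supNorm (b - u)) ≤ Real.exp (-(δ / 4 / n) * Beta.PoissonInterior.supNorm (u - b)) := by
      rw [hε]; exact (exp_flip_quarter hδ0.le hn b u).2
    have hS : ∑ s' ∈ (Finset.univ : Finset Unit), (1 : ℝ) * (4 * kA₁ * Bδ * C₄ * (C₀ / n) * Real.exp (-(ε / 2) * Beta.PoissonInterior.supNorm (b - u)) *
        (1 + 2 * 4 * 3 ^ (4 - 1) * ((4 - 1 - 2).factorial * (2 / (ε / 2)) ^ (4 - 1 - 2) * (1 + 2 / (ε / 2)))))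
        = 4 * kA₁ * Bδ * C₄ * (C₀ / n) * Real.exp (-(ε / 2) * Beta.PoissonInterior.supNorm (b - u)) *
          (1 + 2 * 4 * 3 ^ (4 - 1) * ((4 - 1 - 2).factorial * (2 / (ε / 2)) ^ (4 - 1 - 2) * (1 + 2 / (ε / 2)))) := by simp
    rw [hcard, hS]
    calc (4 : ℝ) * (4 * kA₁ * Bδ * C₄ * (C₀ / n) * Real.exp (-(ε / 2) * Beta.PoissonInterior.supNorm (b - u)) *
          (1 + 2 * 4 * 3 ^ (4 - 1) * ((4 - 1 - 2).factorial * (2 / (ε / 2)) ^ (4 - 1 - 2) * (1 + 2 / (ε / 2)))))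
        ≤ 4 * (4 * kA₁ * Bδ * C₄ * (|C₁| / n) * Real.exp (-(δ / 4 / n) * Beta.PoissonInterior.supNorm (u - b)) * (c2' * (n : ℝ) ^ 2)) := by
          gcongr
      _ = 4 * (4 * kA₁ * C₄ * |C₁| * c2') * Bδ * n * Real.exp (-(δ / 4 / n) * Beta.PoissonInterior.supNorm (u - b)) := by field_simp
  · intro _ _ S
    have h1 := abs_sum_mul_le_of_damped_flat (d := 4) (by norm_num) (a := 2) (by norm_num)
      (by positivity : 0 ≤ 4 * kA₁ * Bδ * C₄) (by positivity : 0 ≤ C₀ / n) hε0 S b u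
      (K := fun x => 4 * kA₁ * Bδ * C₄ * Real.exp (-ε * Beta.PoissonInterior.supNorm (x - b)) / nrm (x - b) ^ 2)
      (f := fun x => C₀ / n * Real.exp (-ε * Beta.PoissonInterior.supNorm (x - u)))
      (fun x _ => by rw [abs_of_nonneg (by have := nrm_pos (x - b); positivity)])
      (fun x _ => by rw [abs_of_nonneg (by positivity)])
    refine le_trans (le_of_eq ?_) (h1.trans (le_of_eq ?_))
    · exact Finset.sum_congr rfl fun x _ => by
        rw [abs_of_nonneg (mul_nonneg (by have := nrm_pos (x - b); positivity) (by positivity))]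
    · push_cast; ring

end Dipole


end Summit.QuantumFields.BalabanUV.Beta.D1BFx.NeedleNdlDipColLetters

end
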